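import Summits.QuantumFields.BalabanUV.T4Continuum.Support.NE7MinActHessianFlatCurl
import HarnessLib

/-!
# NE7EffectiveFormMinimiserUnique — AT THE FLAT DATUM THE VARIATIONAL MINIMISER OF THE EFFECTIVE QUADRATIC FORM IS UNIQUE MODULO CURL-FREE FIELDS (ROAD-G115 §6 (ii), first half)

✓ `NE7MinActHessianFlatCurl.minAct_hessian_flat_curl` characterises `D²(minAct∘chart_1)(0)[v,v]` as the least element of `{ w·Σ_p nhsNormSq(curl_1 X p) : X ∈ skewSub M, Q′X = v }`.
Here: if `X₁`, `X₂` both have `Q′X_i = v` and both ATTAIN that least value, then `curl_1 (X₁ − X₂)(p) = 0` on every plaquette `p` of the period box (and `Q′(X₁ − X₂) = 0`) —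
**`flat_minimiser_unique_mod_closed`**: the minimiser (e.g. `∂_V U_{j+1}|_{V=1} v` of ✓ `NE7MinimiserDerivativeFlat`) is unique modulo CLOSED fields in `ker Q′`.  MECHANISM: the free
quadratic form is the Fréchet Hessian `B = D²𝒜(0)` of `𝒜 = fineAction∘chart_1` (✓ `flat_second_variation`), bilinear and positive semi-definite (`𝒜 ≥ 0 = 𝒜(0)` on skew fields,
✓ p823109 with `c = 0`); the parallelogram identity `B[X₁+X₂]² + B[X₁−X₂]² = 2B[X₁]² + 2B[X₂]²` and minimality at the feasible midpoint `(X₁+X₂)∕2` force `B[X₁−X₂]² ≤ 0`, hence `= 0`,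
hence every `nhsNormSq(curl_1(X₁−X₂) p) = 0`, hence the curl vanishes (`MatrixNorms.opNorm_sq_le_card_mul_nhsNormSq`).
Cell `pub-balaban`, rung (B)+1 sub-cell t4, lineage `b2b-balaban-t4-ne7-p1` (CRUX PROVER NE7 #1 = OWNER of BINDER row NE7), generation 115.  Memo `t4/b2b-balaban-t4-ne7-p1-g115/ROAD-G115.md` §7.
WHAT ([folklore]; 0 def, 0 sorry; `d = 4`, every `U(n)`, `L ≥ 2`).  HONEST FRAMING (page 1): uniqueness MODULO closed fields only — their identification with linearised gauge directions
(discrete de Rham on the box: closed = exact + harmonic) is NOT typed; nothing of Bałaban's asserted; NOT NE7 as a spine node, NOT NE3; spine 0∕9; NOT infinite volume, NOT mass gap, NOT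
BetaPertH, NOT Clay.
-/

set_option autoImplicit false

open scoped BigOperators Matrix Matrix.Norms.L2Operator Topology
open NormedSpace Finset Set Filter Metric

namespace Summit.QuantumFields.BalabanUV.T4Continuum.NE7EffectiveFormMinimiserUnique

open Literature.MathematicalPhysics.QuantumFieldTheory.Balaban1983to89
open B7Prop1Explicit B7Prop2Explicit
open T4AveragingDeficitWall (fineAction curl)
open AveragingDeficitTorusChart (TDir chart chartDir chart_zero isUnitaryCfg_chart)
open AveragingDeficitChartCalculus (contDiffAt_fineAction_chart)
open AveragingDeficitTwoLevelPrep (skewSub)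
open AveragingDeficitMultiLevelPrep (tower levelQ' tower_ne_zero)
open MinimalActionLevels (perWin stepWt stepWt_pos fineAction_nonneg)
open MinimalActionSandwich (minAct)
open MinimalActionRate (sfClass)
open MinimalActionWitness (flatCfg fineAction_flatCfg)
open MatrixNorms (nhsNormSq nhsNormSq_nonneg opNorm_sq_le_card_mul_nhsNormSq)
open NE3FlatHessianCurl (isUnitaryCfg_flatCfg)
open NE7AdmissibleFibreLHC (chart_id_eq_chart_skewP)
open NE7QuadraticGrowthSecondDerivative (second_derivative_ge_of_quadratic_growth)
open NE7MinActHessianFlatCurl (flat_second_variation minAct_hessian_flat_curl)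

noncomputable section

variable {n : Type} [Fintype n] [DecidableEq n]

/-- **UNIQUENESS OF THE VARIATIONAL MINIMISER MODULO CLOSED FIELDS** (see the module docstring). [folklore] -/
theorem flat_minimiser_unique_mod_closed [Nonempty n] {L : ℕ} [NeZero L] (hL : 2 ≤ L) :
    ∃ ε₀ : ℝ, 0 < ε₀ ∧ ∀ ε : ℝ, 0 < ε → ε ≤ ε₀ → ∀ (N : ℕ) [NeZero N], 1 ≤ N → ∀ (j : ℕ) (v : ↥(skewSub 4 n N))
      (X₁ X₂ : ↥(skewSub 4 n (L * tower L N j))),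
      levelQ' L N j (flatCfg : Site 4 → Fin 4 → (Matrix n n ℂ)ˣ) (X₁ : TDir 4 n (L * tower L N j)) = v →
      levelQ' L N j (flatCfg : Site 4 → Fin 4 → (Matrix n n ℂ)ˣ) (X₂ : TDir 4 n (L * tower L N j)) = v →
      ((stepWt 4 L)⁻¹) ^ (j + 1) * ∑ p ∈ perWin 4 (N * L ^ (j + 1)),
              nhsNormSq (curl (flatCfg : Site 4 → Fin 4 → (Matrix n n ℂ)ˣ) (chartDir (ContinuousLinearMap.id ℝ (Matrix n n ℂ)) (L * tower L N j) (X₁ : TDir 4 n (L * tower L N j))) p)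
        = fderiv ℝ (fderiv ℝ (fun y : ↥(skewSub 4 n N) => minAct 4 (sfClass 4 L N ε) L N (j + 1)
            (chart (ContinuousLinearMap.id ℝ (Matrix n n ℂ)) N (flatCfg : Site 4 → Fin 4 → (Matrix n n ℂ)ˣ) (y : TDir 4 n N)))) 0 v v →
      ((stepWt 4 L)⁻¹) ^ (j + 1) * ∑ p ∈ perWin 4 (N * L ^ (j + 1)),
              nhsNormSq (curl (flatCfg : Site 4 → Fin 4 → (Matrix n n ℂ)ˣ) (chartDir (ContinuousLinearMap.id ℝ (Matrix n n ℂ)) (L * tower L N j) (X₂ : TDir 4 n (L * tower L N j))) p)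
        = fderiv ℝ (fderiv ℝ (fun y : ↥(skewSub 4 n N) => minAct 4 (sfClass 4 L N ε) L N (j + 1)
            (chart (ContinuousLinearMap.id ℝ (Matrix n n ℂ)) N (flatCfg : Site 4 → Fin 4 → (Matrix n n ℂ)ˣ) (y : TDir 4 n N)))) 0 v v →
      ∀ p ∈ perWin 4 (N * L ^ (j + 1)),
        curl (flatCfg : Site 4 → Fin 4 → (Matrix n n ℂ)ˣ) (chartDir (ContinuousLinearMap.id ℝ (Matrix n n ℂ)) (L * tower L N j) ((X₁ - X₂ : ↥(skewSub 4 n (L * tower L N j))) : TDir 4 n (L * tower L N j))) p = 0 := by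
  have hL1 : 1 ≤ L := by omega
  obtain ⟨ε₀, hε₀, H⟩ := minAct_hessian_flat_curl (n := n) hL
  refine ⟨ε₀, hε₀, fun ε hε hεle N _ hN j v X₁ X₂ hQ₁ hQ₂ hX₁ hX₂ => ?_⟩
  obtain ⟨-, hleast⟩ := H ε hε hεle N hN j
  haveI : NeZero (L * tower L N j) := ⟨Nat.mul_ne_zero (NeZero.ne L) (tower_ne_zero L N j)⟩
  haveI : CompleteSpace ↥(skewSub 4 n (L * tower L N j)) := FiniteDimensional.complete ℝ _
  set V₀ : Site 4 → Fin 4 → (Matrix n n ℂ)ˣ := flatCfg with hV₀def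
  set W := perWin 4 (N * L ^ (j + 1)) with hW
  set w : ℝ := ((stepWt 4 L)⁻¹) ^ (j + 1) with hw
  have hw0 : 0 < w := pow_pos (inv_pos.mpr (stepWt_pos (d := 4) L hL1)) _
  set μ : ℝ := fderiv ℝ (fderiv ℝ (fun y : ↥(skewSub 4 n N) => minAct 4 (sfClass 4 L N ε) L N (j + 1)
    (chart (ContinuousLinearMap.id ℝ (Matrix n n ℂ)) N V₀ (y : TDir 4 n N)))) 0 v v with hμ
  -- the free quadratic form as the Fréchet Hessian of the chart action: bilinear, positive semi-definite
  set A : ↥(skewSub 4 n (L * tower L N j)) → ℝ := fun Φ => fineAction (chart (ContinuousLinearMap.id ℝ (Matrix n n ℂ)) (L * tower L N j) V₀ (Φ : TDir 4 n (L * tower L N j))) W with hA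
  set B := fderiv ℝ (fderiv ℝ A) 0 with hB
  have hAc : ContDiffAt ℝ 2 A 0 := by
    have h1 : ContDiffAt ℝ 2 (fun Φ : TDir 4 n (L * tower L N j) => fineAction (chart (ContinuousLinearMap.id ℝ (Matrix n n ℂ)) (L * tower L N j) V₀ Φ) W) ((skewSub 4 n (L * tower L N j)).subtypeL 0) := by
      rw [map_zero]; exact contDiffAt_fineAction_chart (m := 2) (ContinuousLinearMap.id ℝ (Matrix n n ℂ)) (L * tower L N j) V₀ W 0
    exact h1.comp 0 (skewSub 4 n (L * tower L N j)).subtypeL.contDiff.contDiffAt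
  have hA0 : A 0 = 0 := by simp only [hA, Submodule.coe_zero, chart_zero, hV₀def, fineAction_flatCfg]
  have hgrowth : ∀ᶠ Φ : ↥(skewSub 4 n (L * tower L N j)) in 𝓝 0, 0 * ‖Φ - 0‖ ^ 2 ≤ A Φ - A 0 := Filter.Eventually.of_forall fun Φ => by
    rw [zero_mul, hA0, sub_zero]
    show 0 ≤ fineAction (chart (ContinuousLinearMap.id ℝ (Matrix n n ℂ)) (L * tower L N j) V₀ (Φ : TDir 4 n (L * tower L N j))) W
    rw [chart_id_eq_chart_skewP _ Φ.2]
    exact fineAction_nonneg (isUnitaryCfg_chart (L * tower L N j) isUnitaryCfg_flatCfg _) W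
  have hpsd : ∀ Z : ↥(skewSub 4 n (L * tower L N j)), 0 ≤ B Z Z := fun Z => by
    have h := second_derivative_ge_of_quadratic_growth hAc le_rfl hgrowth Z
    rwa [zero_mul] at h
  have hcurl : ∀ X : ↥(skewSub 4 n (L * tower L N j)), B X X = ∑ p ∈ W, nhsNormSq (curl V₀ (chartDir (ContinuousLinearMap.id ℝ (Matrix n n ℂ)) (L * tower L N j) (X : TDir 4 n (L * tower L N j))) p) :=
    fun X => by rw [hB, hA, hV₀def, hW]; exact flat_second_variation (perWin 4 (N * L ^ (j + 1))) X
  -- the two minimisers and their feasible midpoint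
  have h1 : w * B X₁ X₁ = μ := by rw [hcurl]; exact hX₁
  have h2 : w * B X₂ X₂ = μ := by rw [hcurl]; exact hX₂
  set s : ↥(skewSub 4 n (L * tower L N j)) := X₁ + X₂ with hs
  set δ : ↥(skewSub 4 n (L * tower L N j)) := X₁ - X₂ with hδ
  have hmid : μ ≤ w * B ((1 / 2 : ℝ) • s) ((1 / 2 : ℝ) • s) := by
    refine hleast v |>.2 ⟨(1 / 2 : ℝ) • s, ?_, ?_⟩
    · rw [Submodule.coe_smul, map_smul, hs, Submodule.coe_add, map_add, hQ₁, hQ₂]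
      rw [← two_smul ℝ v, smul_smul]; norm_num
    · rw [← hcurl]
  have hpar : B s s + B δ δ = 2 * B X₁ X₁ + 2 * B X₂ X₂ := by
    simp only [hs, hδ, map_add, map_sub, add_apply, sub_apply]
    ring
  have hmid' : B ((1 / 2 : ℝ) • s) ((1 / 2 : ℝ) • s) = (1 / 4 : ℝ) * B s s := by
    have e1 : B ((1 / 2 : ℝ) • s) = (1 / 2 : ℝ) • B s := map_smul B _ _
    rw [e1, smul_apply, map_smul, smul_eq_mul, smul_eq_mul]; ring
  have hδ0 : B δ δ = 0 := by
    have hle : w * B δ δ ≤ 0 := by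
      have e : w * B δ δ = 2 * (w * B X₁ X₁) + 2 * (w * B X₂ X₂) - 4 * (w * B ((1 / 2 : ℝ) • s) ((1 / 2 : ℝ) • s)) := by
        rw [hmid']; linear_combination w * hpar
      rw [e, h1, h2]; linarith
    have hge : 0 ≤ w * B δ δ := mul_nonneg hw0.le (hpsd δ)
    have h0 : w * B δ δ = 0 := le_antisymm hle hge
    rcases mul_eq_zero.mp h0 with h | h
    · exact absurd h hw0.ne'
    · exact h
  -- every plaquette term vanishes
  rw [hcurl δ] at hδ0
  intro p hp
  have hterm := (Finset.sum_eq_zero_iff_of_nonneg (fun q _ => nhsNormSq_nonneg _)).mp hδ0 p hp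
  have hsq : ‖curl V₀ (chartDir (ContinuousLinearMap.id ℝ (Matrix n n ℂ)) (L * tower L N j) ((δ : ↥(skewSub 4 n (L * tower L N j))) : TDir 4 n (L * tower L N j))) p‖ ^ 2 ≤ 0 := by
    have h := opNorm_sq_le_card_mul_nhsNormSq (curl V₀ (chartDir (ContinuousLinearMap.id ℝ (Matrix n n ℂ)) (L * tower L N j) ((δ : ↥(skewSub 4 n (L * tower L N j))) : TDir 4 n (L * tower L N j))) p)
    rw [hterm, mul_zero] at h; exact h
  have hn : ‖curl V₀ (chartDir (ContinuousLinearMap.id ℝ (Matrix n n ℂ)) (L * tower L N j) ((δ : ↥(skewSub 4 n (L * tower L N j))) : TDir 4 n (L * tower L N j))) p‖ = 0 :=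
    le_antisymm (by nlinarith [norm_nonneg (curl V₀ (chartDir (ContinuousLinearMap.id ℝ (Matrix n n ℂ)) (L * tower L N j) ((δ : ↥(skewSub 4 n (L * tower L N j))) : TDir 4 n (L * tower L N j))) p)]) (norm_nonneg _)
  exact norm_eq_zero.mp hn

end

end Summit.QuantumFields.BalabanUV.T4Continuum.NE7EffectiveFormMinimiserUnique
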